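import Summits.MatrixMultiplication.MatrixMultiplication.Theorems.FarEdgeDescentPencilGram
import HarnessLib

/-!
# Pencil Gram invariants of the BCZ line, II: the closed line is a total degeneration antichain

Route `FarEdgeDescent` (cell `decomp-mm`, lens 2 «structural dichotomy (special vs generic)»,
gen 39), Kernel XIV; support for the aside `SubLogRate` (stmt-MatrixMultiplication-25371).

`FarEdgeDescentLineRigidity` decided `𝔖(q) ⊵ 𝔖(q') ↔ q' ∈ {q, q⁻¹}` on the closed BCZ line
`{𝔖(q) : q ∈ K}` (the `(GL₄)³`-normal forms of the same-support class of `⟨2,2,2⟩`,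
Bläser–Christandl–Zuiddam) under the proviso `q' ≠ 0 ∨ q ∈ {0,1}`: the arrows
`𝔖(q) → 𝔖(0)`, `q ∉ {0,1}` — generic member to the special corank-one member `⟨2,2,2⟩` minus a
term — survived every first-order test (equal stabiliser dimensions `5`, equal pencil-orbit
dimensions, consistent trailing determinant classes).  This file closes them in characteristic
`≠ 2`:

* `pencil_caseA`, `pencil_caseB`: the **order comparison** in the three relative invariants of
  Part I — if the Gram matrices of `(det X, det_q X) ∘ Bᵀ` are `ε^{a₁}(κ₁Ĵ_1 + …)`,
  `ε^{a₂}(κ₂Ĵ_0 + …)` (or swapped), then `det S_q = q² det S_1` forbids `a₂ ≥ a₁` (value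
  `q²κ₁⁴ det Ĵ_1 ≠ 0` against `det(κ₂Ĵ_0) = 0`) and `tr(adj S_1·S_q) = (2+2q) det S_1` forbids
  `a₂ < a₁` (trailing value `2κ₁³κ₂ det Ĵ_1 ≠ 0` at order `3a₁ + a₂ < 4a₁`);
* `fam_not_algDegeneratesTo_fam_zero`: **`𝔖(q) ⋭ 𝔖(0)` for every `q ≠ 0`** (char `K ≠ 2`) — a
  second, pencil-invariant proof of `⟨2,2,2⟩ ⋭ 𝔖(0)` included (`q = 1`);
* `fam_algDegeneratesTo_fam_iff`: **`𝔖(q) ⊵ 𝔖(q') ↔ q' = q ∨ q q' = 1` for ALL `q, q'`**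
  (char `≠ 2`, e.g. `ℂ`: `fam_algDegeneratesTo_fam_iff_complex`) — the proviso of Kernel XII is
  gone: degeneration = restriction = the inversion involution on the whole closed line
  (`fam_algDegeneratesTo_iff_restrictsTo`, `no_strict_degeneration`), `𝔖(0)` is `⊴`-isolated
  (`fam_zero_isolated`), and the Hasse diagram of `⊴` on the closed line is EMPTY: a total
  antichain of the classes `{𝔖(1) ≅ ⟨2,2,2⟩}`, `{𝔖(0)}`, `{𝔖(q), 𝔖(q⁻¹)}`.

Lens reading (special vs generic): inside the same-support class of `⟨2,2,2⟩` no member — special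
(`q ∈ {0,1}`) or generic — degenerates to any other; every asymptotic-rank transfer along the line
must be genuinely asymptotic (`N → ∞`), which is where the cut
`FiniteSaturation ∧ AnchoredLogConvexity ⟹ ω = 2` lives.  Characteristic `2` is left open (the
polarised discriminant `tr(adj S_1·S_q)` has trailing value `2κ₁³κ₂ det Ĵ_1`).

References: P. Bürgisser, M. Clausen, M. A. Shokrollahi, *Algebraic Complexity Theory* (1997),
(15.19), §20.2 [BurgisserClausenShokrollahi1997]; M. Bläser, M. Christandl, J. Zuiddam,
arXiv:1705.09652, §2, Lemma 3 [BlaserChristandlZuiddam2017]; J. M. Landsberg, *Geometry and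
Complexity Theory* (2017), §3.4.4 [Landsberg2017].
-/

noncomputable section

open scoped BigOperators Polynomial Matrix

set_option linter.dupNamespace false

namespace Summit.MatrixMultiplication.MatrixMultiplication.Theorems.FarEdgeDescentLineAntichain

open Literature.Computability.AlgebraicComplexity
open Summit.MatrixMultiplication.MatrixMultiplication.Theorems.FarEdgeDescentSignTwistDet
open Summit.MatrixMultiplication.MatrixMultiplication.Theorems.FarEdgeDescentWeightFamily
  (famW fam fam_one)
open Summit.MatrixMultiplication.MatrixMultiplication.Theorems.FarEdgeDescentWeightFamilyDet
open Summit.MatrixMultiplication.MatrixMultiplication.Theorems.FarEdgeDescentLineDetPair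
open Summit.MatrixMultiplication.MatrixMultiplication.Theorems.FarEdgeDescentLineRigidity
  (trailing_identity trailing_isHomogeneous fam_zero_not_algDegeneratesTo_fam)
open Summit.MatrixMultiplication.MatrixMultiplication.Theorems.FarEdgeDescentPencilGram
open Summit.MatrixMultiplication.MatrixMultiplication.Theorems.FarEdgeDescentStratumSymmetries
  (fam_restrictsTo_fam_inv)

universe u

/-! ## Order comparison in `K[ε]` -/

section Orders
variable {K : Type u} [Field K]

/-- `ε^m f = ε^n g`, `m ≤ n`, `g(0) = 0` forces `f(0) = 0`. [folklore] -/
theorem eval_zero_of_X_pow_mul_eq_of_le {f g : K[X]} {m n : ℕ} (hmn : m ≤ n)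
    (h : (Polynomial.X : K[X]) ^ m * f = Polynomial.X ^ n * g) (hg : g.eval 0 = 0) :
    f.eval 0 = 0 := by
  obtain ⟨d, rfl⟩ := Nat.exists_eq_add_of_le hmn
  rw [pow_add, mul_assoc] at h
  have hf : f = Polynomial.X ^ d * g := mul_left_cancel₀ (pow_ne_zero _ Polynomial.X_ne_zero) h
  rw [hf, Polynomial.eval_mul, Polynomial.eval_pow, Polynomial.eval_X, hg, mul_zero]

/-- `ε^m f = ε^n g`, `m < n`, forces `f(0) = 0`. [folklore] -/
theorem eval_zero_of_X_pow_mul_eq_of_lt {f g : K[X]} {m n : ℕ} (hmn : m < n)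
    (h : (Polynomial.X : K[X]) ^ m * f = Polynomial.X ^ n * g) : f.eval 0 = 0 := by
  obtain ⟨d, rfl⟩ := Nat.exists_eq_add_of_le hmn.le
  have hd : d ≠ 0 := by omega
  rw [pow_add, mul_assoc] at h
  have hf : f = Polynomial.X ^ d * g := mul_left_cancel₀ (pow_ne_zero _ Polynomial.X_ne_zero) h
  rw [hf, Polynomial.eval_mul, Polynomial.eval_pow, Polynomial.eval_X, zero_pow hd, zero_mul]

end Orders

/-! ## The pencil lemma: orders in `det S_q = q² det S_1`, `tr(adj S_1 S_q) = (2+2q) det S_1` -/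

section PencilLemma
variable {K : Type u} [Field K]

/-- `card {x₀₀,x₀₁,x₁₀,x₁₁} = 4`. [folklore] -/
theorem card_Idx : Fintype.card Idx = 4 := by
  simp [Fintype.card_prod]

/-- `det Ĵ_1 ≠ 0`. [folklore] -/
theorem det_Jh_one_ne_zero : (Jh K 1).det ≠ 0 := fun e => by
  have h := det_Jh_one_mul_self K
  rw [e, zero_mul] at h
  exact zero_ne_one h

/-- `(det S)(0) = det S(0)`. [folklore] -/
theorem eval_det (S : Matrix Idx Idx K[X]) :
    S.det.eval 0 = (S.map (Polynomial.eval 0)).det := by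
  rw [← Polynomial.coe_evalRingHom, RingHom.map_det, RingHom.mapMatrix_apply]

/-- `tr(adj S · T)(0) = tr(adj S(0) · T(0))`. [folklore] -/
theorem eval_trace_adjugate_mul (S T : Matrix Idx Idx K[X]) :
    (S.adjugate * T).trace.eval 0 =
      ((S.map (Polynomial.eval 0)).adjugate * T.map (Polynomial.eval 0)).trace := by
  rw [← Polynomial.coe_evalRingHom, AddMonoidHom.map_trace, Matrix.map_mul,
    ← RingHom.mapMatrix_apply, RingHom.map_adjugate, RingHom.mapMatrix_apply]

/-- `det(κ Ĵ_f) = κ⁴ det Ĵ_f`, `adj(κ Ĵ_1) = κ³ det Ĵ_1 · Ĵ_1`: the trailing values.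
[folklore] -/
theorem trace_adjugate_smul_Jh_one_mul (κ κ' : K) :
    ((κ • Jh K 1).adjugate * (κ' • Jh K 0)).trace = 2 * κ ^ 3 * κ' * (Jh K 1).det := by
  rw [Matrix.adjugate_smul, card_Idx, adjugate_Jh_one, Matrix.smul_mul, Matrix.smul_mul,
    Matrix.mul_smul, Matrix.trace_smul, Matrix.trace_smul, Matrix.trace_smul,
    trace_Jh_one_mul_Jh_zero, smul_eq_mul, smul_eq_mul, smul_eq_mul]
  norm_num
  ring

/-- **Pencil lemma, case A** (`u - v` carries `det X`, `u - q v` carries `x₀₀x₁₁`): impossible for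
`q ≠ 0`, `char K ≠ 2`. [cite: BurgisserClausenShokrollahi1997, (15.19)] -/
theorem pencil_caseA (h2 : (2 : K) ≠ 0) {q κ₁ κ₂ : K} (hq : q ≠ 0) (hκ₁ : κ₁ ≠ 0) (hκ₂ : κ₂ ≠ 0)
    {B S₁ S₂ : Matrix Idx Idx K[X]} {a₁ a₂ : ℕ}
    (h₁ : gram B 1 = (Polynomial.X : K[X]) ^ a₁ • S₁)
    (h₁0 : S₁.map (Polynomial.eval 0) = κ₁ • Jh K 1)
    (h₂ : gram B (Polynomial.C q) = (Polynomial.X : K[X]) ^ a₂ • S₂)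
    (h₂0 : S₂.map (Polynomial.eval 0) = κ₂ • Jh K 0) : False := by
  have hJ := det_Jh_one_ne_zero (K := K)
  have ev₁ : S₁.det.eval 0 = κ₁ ^ 4 * (Jh K 1).det := by
    rw [eval_det, h₁0, Matrix.det_smul, card_Idx]
  have ev₂ : S₂.det.eval 0 = 0 := by
    rw [eval_det, h₂0, Matrix.det_smul, det_Jh_zero, mul_zero]
  have evt : (S₁.adjugate * S₂).trace.eval 0 = 2 * κ₁ ^ 3 * κ₂ * (Jh K 1).det := by
    rw [eval_trace_adjugate_mul, h₁0, h₂0, trace_adjugate_smul_Jh_one_mul]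
  rcases (Nat.lt_or_ge a₂ a₁).symm with hle | hlt
  · have hI := det_gram_eq B (Polynomial.C q)
    rw [h₁, h₂, Matrix.det_smul, Matrix.det_smul, card_Idx, ← pow_mul, ← pow_mul] at hI
    have hI' : (Polynomial.X : K[X]) ^ (a₁ * 4) * (Polynomial.C q ^ 2 * S₁.det) =
        Polynomial.X ^ (a₂ * 4) * S₂.det := by
      rw [hI]
      ring
    have h0 := eval_zero_of_X_pow_mul_eq_of_le (by omega) hI' ev₂
    rw [Polynomial.eval_mul, Polynomial.eval_pow, Polynomial.eval_C, ev₁] at h0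
    exact mul_ne_zero (pow_ne_zero _ hq) (mul_ne_zero (pow_ne_zero _ hκ₁) hJ) h0
  · have hI := trace_adjugate_gram_one_mul B (Polynomial.C q)
    rw [h₁, h₂, Matrix.adjugate_smul, Matrix.det_smul, card_Idx, Matrix.smul_mul,
      Matrix.mul_smul, Matrix.trace_smul, Matrix.trace_smul, smul_eq_mul, smul_eq_mul] at hI
    norm_num at hI
    have hI' : (Polynomial.X : K[X]) ^ (3 * a₁ + a₂) * (S₁.adjugate * S₂).trace =
        Polynomial.X ^ (4 * a₁) * ((2 + 2 * Polynomial.C q) * S₁.det) := by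
      rw [pow_add, pow_mul, pow_mul]
      linear_combination hI
    have h0 := eval_zero_of_X_pow_mul_eq_of_lt (by omega) hI'
    rw [evt] at h0
    exact mul_ne_zero (mul_ne_zero (mul_ne_zero h2 (pow_ne_zero _ hκ₁)) hκ₂) hJ h0

/-- **Pencil lemma, case B** (`u - v` carries `x₀₀x₁₁`, `u - q v` carries `det X`): impossible for
`q ≠ 0`, `char K ≠ 2`. [cite: BurgisserClausenShokrollahi1997, (15.19)] -/
theorem pencil_caseB (h2 : (2 : K) ≠ 0) {q κ₁ κ₂ : K} (hq : q ≠ 0) (hκ₁ : κ₁ ≠ 0) (hκ₂ : κ₂ ≠ 0)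
    {B S₁ S₂ : Matrix Idx Idx K[X]} {a₁ a₂ : ℕ}
    (h₁ : gram B 1 = (Polynomial.X : K[X]) ^ a₁ • S₁)
    (h₁0 : S₁.map (Polynomial.eval 0) = κ₁ • Jh K 0)
    (h₂ : gram B (Polynomial.C q) = (Polynomial.X : K[X]) ^ a₂ • S₂)
    (h₂0 : S₂.map (Polynomial.eval 0) = κ₂ • Jh K 1) : False := by
  have hJ := det_Jh_one_ne_zero (K := K)
  have ev₁ : S₁.det.eval 0 = 0 := by
    rw [eval_det, h₁0, Matrix.det_smul, det_Jh_zero, mul_zero]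
  have ev₂ : S₂.det.eval 0 = κ₂ ^ 4 * (Jh K 1).det := by
    rw [eval_det, h₂0, Matrix.det_smul, card_Idx]
  have evt : (S₂.adjugate * S₁).trace.eval 0 = 2 * κ₂ ^ 3 * κ₁ * (Jh K 1).det := by
    rw [eval_trace_adjugate_mul, h₁0, h₂0, trace_adjugate_smul_Jh_one_mul]
  rcases (Nat.lt_or_ge a₁ a₂).symm with hle | hlt
  · have hI := det_gram_eq B (Polynomial.C q)
    rw [h₁, h₂, Matrix.det_smul, Matrix.det_smul, card_Idx, ← pow_mul, ← pow_mul] at hI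
    have hI' : (Polynomial.X : K[X]) ^ (a₂ * 4) * S₂.det =
        Polynomial.X ^ (a₁ * 4) * (Polynomial.C q ^ 2 * S₁.det) := by
      rw [hI]
      ring
    have hg : (Polynomial.C q ^ 2 * S₁.det).eval 0 = 0 := by
      rw [Polynomial.eval_mul, ev₁, mul_zero]
    have h0 := eval_zero_of_X_pow_mul_eq_of_le (by omega) hI' hg
    rw [ev₂] at h0
    exact mul_ne_zero (pow_ne_zero _ hκ₂) hJ h0
  · have hI := mul_trace_adjugate_gram_mul B (Polynomial.C q)
    rw [h₁, h₂, Matrix.adjugate_smul, Matrix.det_smul, card_Idx, Matrix.smul_mul,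
      Matrix.mul_smul, Matrix.trace_smul, Matrix.trace_smul, smul_eq_mul, smul_eq_mul] at hI
    norm_num at hI
    have hI' : (Polynomial.X : K[X]) ^ (3 * a₂ + a₁) *
        (Polynomial.C q * (S₂.adjugate * S₁).trace) =
        Polynomial.X ^ (4 * a₂) * ((2 + 2 * Polynomial.C q) * S₂.det) := by
      rw [pow_add, pow_mul, pow_mul]
      linear_combination hI
    have h0 := eval_zero_of_X_pow_mul_eq_of_lt (by omega) hI'
    rw [Polynomial.eval_mul, Polynomial.eval_C, evt] at h0
    exact mul_ne_zero hq (mul_ne_zero (mul_ne_zero (mul_ne_zero h2 (pow_ne_zero _ hκ₂)) hκ₁) hJ) h0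

end PencilLemma

/-! ## The last arrows: `𝔖(q) ⋭ 𝔖(0)` -/

section Main
variable (K : Type u) [Field K]

/-- **`𝔖(q) ⋭ 𝔖(0)` for every `q ≠ 0`, `char K ≠ 2`.**  The arrows left open by
`FarEdgeDescentLineRigidity.fam_algDegeneratesTo_fam_iff` (`q ∉ {0,1}`); for `q = 1` a second
proof of `⟨2,2,2⟩ ⋭ 𝔖(0)`. [cite: BurgisserClausenShokrollahi1997, (15.19)]
[cite: BlaserChristandlZuiddam2017, §2] -/
theorem fam_not_algDegeneratesTo_fam_zero (h2 : (2 : K) ≠ 0) {q : K} (hq0 : q ≠ 0) :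
    ¬ AlgDegeneratesTo (fam K q) (fam K 0) := by
  rintro ⟨h, A, B, C, hd⟩
  obtain ⟨c, htc⟩ := trailing_identity K hd
  obtain ⟨hP, hQ⟩ := trailing_isHomogeneous K B q
  have e1 : yv B (0, 0) * yv B (1, 1) - yv B (0, 1) * yv B (1, 0) =
      yv B (0, 0) * yv B (1, 1) - yv B (0, 1) * yv B (1, 0) *
        Polynomial.C (MvPolynomial.C (1 : K)) := by
    rw [map_one, map_one, mul_one]
  rcases pair_of_detX_mul_eq hP hQ (detXq_ne_zero K 0) htc with
    ⟨⟨κ₁, hκ₁, e₁⟩, ⟨κ₂, hκ₂, e₂⟩⟩ | ⟨⟨κ₁, hκ₁, e₁⟩, ⟨κ₂, hκ₂, e₂⟩⟩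
  · rw [← detXq_one, e1] at e₁
    obtain ⟨S₁, hS₁, hS₁0⟩ := gram_decomp e₁
    obtain ⟨S₂, hS₂, hS₂0⟩ := gram_decomp e₂
    rw [map_one] at hS₁
    exact pencil_caseA h2 hq0 hκ₁ hκ₂ hS₁ hS₁0 hS₂ hS₂0
  · rw [e1] at e₁
    rw [← detXq_one] at e₂
    obtain ⟨S₁, hS₁, hS₁0⟩ := gram_decomp e₁
    obtain ⟨S₂, hS₂, hS₂0⟩ := gram_decomp e₂
    rw [map_one] at hS₁
    exact pencil_caseB h2 hq0 hκ₁ hκ₂ hS₁ hS₁0 hS₂ hS₂0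

/-- **`𝔖(0)` is `⊴`-isolated on the closed line** (char `≠ 2`): `𝔖(q) ⊵ 𝔖(0) ↔ q = 0 ↔ 𝔖(0) ⊵ 𝔖(q)`.
[cite: BurgisserClausenShokrollahi1997, (15.19)] -/
theorem fam_zero_isolated (h2 : (2 : K) ≠ 0) (q : K) :
    (AlgDegeneratesTo (fam K q) (fam K 0) ↔ q = 0) ∧
      (AlgDegeneratesTo (fam K 0) (fam K q) ↔ q = 0) := by
  refine ⟨⟨fun hd => by_contra fun hq => fam_not_algDegeneratesTo_fam_zero K h2 hq hd,
    fun e => ?_⟩, ⟨fun hd => by_contra fun hq => fam_zero_not_algDegeneratesTo_fam K hq hd,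
    fun e => ?_⟩⟩
  · rw [e]
    exact (TensorRestrictsTo.refl _).algDegeneratesTo
  · rw [e]
    exact (TensorRestrictsTo.refl _).algDegeneratesTo

end Main

/-! ## The degeneration order on the whole closed line (universe `0`, as Kernel XII) -/

section Line
variable (K : Type) [Field K]

/-- **The degeneration order on the closed BCZ line, no proviso** (char `≠ 2`):
`𝔖(q) ⊵ 𝔖(q') ↔ q' = q ∨ q q' = 1` for all `q, q'`.
[cite: BlaserChristandlZuiddam2017, §2] [cite: BurgisserClausenShokrollahi1997, (15.19), §20.2] -/
theorem fam_algDegeneratesTo_fam_iff (h2 : (2 : K) ≠ 0) (q q' : K) :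
    AlgDegeneratesTo (fam K q) (fam K q') ↔ q' = q ∨ q * q' = 1 := by
  by_cases hq'0 : q' = 0
  · subst hq'0
    refine ⟨fun hd => ?_, ?_⟩
    · by_cases hq : q = 0
      · exact Or.inl hq.symm
      · exact absurd hd (fam_not_algDegeneratesTo_fam_zero K h2 hq)
    · rintro (e | e)
      · rw [← e]
        exact (TensorRestrictsTo.refl _).algDegeneratesTo
      · rw [mul_zero] at e
        exact absurd e zero_ne_one
  · exact FarEdgeDescentLineRigidity.fam_algDegeneratesTo_fam_iff K fun e => absurd e hq'0

/-- **On the closed line degeneration is restriction** (char `≠ 2`, no proviso).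
[cite: BurgisserClausenShokrollahi1997, §20.2] -/
theorem fam_algDegeneratesTo_iff_restrictsTo (h2 : (2 : K) ≠ 0) (q q' : K) :
    AlgDegeneratesTo (fam K q) (fam K q') ↔ TensorRestrictsTo (fam K q) (fam K q') := by
  refine ⟨fun hd => ?_, fun h => h.algDegeneratesTo⟩
  rcases (fam_algDegeneratesTo_fam_iff K h2 q q').mp hd with e | h
  · rw [e]
    exact TensorRestrictsTo.refl _
  · have hq0 : q ≠ 0 := fun e => zero_ne_one (by rwa [e, zero_mul] at h)
    rw [eq_inv_of_mul_eq_one_right h]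
    exact fam_restrictsTo_fam_inv hq0

/-- **The closed line is a total antichain**: every degeneration `𝔖(q) ⊵ 𝔖(q')` is invertible —
`𝔖(q') ⊵ 𝔖(q)` as well (indeed both are restrictions); no strict degeneration exists
(char `≠ 2`). [cite: BurgisserClausenShokrollahi1997, §20.2] -/
theorem no_strict_degeneration (h2 : (2 : K) ≠ 0) (q q' : K) :
    AlgDegeneratesTo (fam K q) (fam K q') ↔ AlgDegeneratesTo (fam K q') (fam K q) := by
  rw [fam_algDegeneratesTo_fam_iff K h2, fam_algDegeneratesTo_fam_iff K h2]
  constructor <;> rintro (e | h)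
  · exact Or.inl e.symm
  · exact Or.inr (by rwa [mul_comm] at h)
  · exact Or.inl e.symm
  · exact Or.inr (by rwa [mul_comm] at h)

/-- **The classes of the line**: `𝔖(q)` and `𝔖(q')` are `⊴`-comparable iff they are mutual
restrictions iff `q' ∈ {q, q⁻¹}`; otherwise incomparable (char `≠ 2`).
[cite: BlaserChristandlZuiddam2017, §2] -/
theorem comparable_iff (h2 : (2 : K) ≠ 0) (q q' : K) :
    (AlgDegeneratesTo (fam K q) (fam K q') ∨ AlgDegeneratesTo (fam K q') (fam K q)) ↔
      (TensorRestrictsTo (fam K q) (fam K q') ∧ TensorRestrictsTo (fam K q') (fam K q)) := by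
  rw [← fam_algDegeneratesTo_iff_restrictsTo K h2, ← fam_algDegeneratesTo_iff_restrictsTo K h2,
    ← no_strict_degeneration K h2 q q', or_self, and_self]

/-- **Over `ℂ`**: `𝔖(q) ⊵ 𝔖(q') ↔ q' = q ∨ q q' = 1`, all `q, q' ∈ ℂ` — the degeneration order on
the same-support class of `⟨2,2,2⟩` is the graph of the inversion involution.
[cite: BlaserChristandlZuiddam2017, §2] -/
theorem fam_algDegeneratesTo_fam_iff_complex (q q' : ℂ) :
    AlgDegeneratesTo (fam ℂ q) (fam ℂ q') ↔ q' = q ∨ q * q' = 1 :=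
  fam_algDegeneratesTo_fam_iff ℂ two_ne_zero q q'

end Line

end Summit.MatrixMultiplication.MatrixMultiplication.Theorems.FarEdgeDescentLineAntichain

end
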